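import Summits.CriticalPhenomena.PercolationContinuityZ3.Theorems.SahiMasterFamilyPointwise
import Summits.CriticalPhenomena.PercolationContinuityZ3.Theorems.SahiMasterFamilyPrincipalCapC3
import Summits.CriticalPhenomena.PercolationContinuityZ3.Theorems.PercNearOneGluingNoHeavyLowerTailSahiCombStrata
import Summits.CriticalPhenomena.PercolationContinuityZ3.Theorems.PercNearOneGluingNoHeavyLowerTailSahiCombDomination
import Summits.CriticalPhenomena.PercolationContinuityZ3.Theorems.PercNearOneGluingNoHeavyLowerTailSahiCombCoreThree
import Summits.CriticalPhenomena.PercolationContinuityZ3.Theorems.PercNearOneGluingNoHeavyLowerTailSahiCombMeetAbsorbing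

/-!
# The pointwise zero locus of `E_k` on the certified strata: principal cap (a NEW comb stratum), the five comb strata,
# the `P`-class, cores of `≤ 3` coordinates and meet-absorbing families at EVERY order

Unit `prim-master-conj` (crux anchor stmt-CriticalPhenomena-4575, helper work), gen 13; companion of `SahiMasterFamilyPointwise.lean`.
There: a comb (tensor-Bernstein) certificate for `p ↦ E_k(μ_p; 1_U)` plus (EQI-k) (`GluedFrames.masterFamilyIdentEqIff_all`) makes
the master equality conjecture POINTWISE for the family (`Pointwise.sahiE_ind_eq_zero_iff_of_combPos`).  Here the harvest:

* **(M⁺-3) on the PRINCIPAL-CAP stratum** (`combPos_sahiE3_of_principalCap`; new at the comb level — seat P4's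
  `PrincipalCapC3.sahiE3_nonneg_of_principalCap` is the law-level statement): if `A ∩ B ∩ C = {T | c ⊆ T}` is a cylinder then,
  with the disjointified cores `K_A ⊔ K_B ⊔ K_C = c` of P4's proof and `P_X = μ[K_X]`,
  `E₃ = (P_A−μA)(P_B−μB)P_C + (P_C−μC)[(P_A−μA)P_B + μA(P_B−μB)] + 2μ(ABC ∖ [c]) + μA·μ([K_B∪K_C] ∖ BC) + μB·μ([K_A∪K_C] ∖ AC)`
  `+ μC·μ([K_A∪K_B] ∖ AB)` — seven products of probabilities and defect moments of multidegree `≤ 3`.  Hence pointwise (EQ-3) there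
  (`sahiE_three_ind_eq_zero_iff_of_principalCap`): at every interior `p`, `E₃(μ_p) = 0 ↔ (A,B,C) ∈ Z₃`.
* **Pointwise (EQ-3) on the five comb strata of `…SahiCombStrata`** (comparable pair / cylinder member / independent member / a deleted
  pair in `Z₂` / a member containing the meet of the other two: `sahiE_three_ind_eq_zero_iff_of_not_residual_comb`) and on the
  **`P`-class** (a pairwise intersection is a cylinder: `sahiE_three_ind_eq_zero_iff_of_pairInter_eq_cylinder`).  The tree had the
  law-level "density-free zeros" on these classes; the `↔ Z₃` conclusion is new.
* **Pointwise (EQ-k) at EVERY order** for families with a core of `≤ 3` coordinates (`sahiE_ind_eq_zero_iff_of_core_le_three`, from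
  `SahiCombCore.combPos_sahiE_ind_of_core_le_three`) and for triplewise meet-absorbing families — in particular chains and meet towers
  (`sahiE_ind_eq_zero_iff_of_triplewise`).
On each class the strict form follows: outside `Z_k`, `E_k(μ_p; 1_U) > 0` on the whole open cube (`Pointwise.sahiE_ind_pos_of_combPos`).
Nothing here asserts (EQ-k), (M-k) or (M⁺-k) in general.  Axioms standard. [this work]
-/

noncomputable section

open scoped Classical

namespace Summit.CriticalPhenomena.PercolationContinuityZ3.Theorems

open Finset Function MeasureTheory
open Literature.Combinatorics.Sahi2008
open Literature.Probability.LatticeModels (prodBernoulli sahiE3 sahiE3_def)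
open Literature.Probability.LatticeModels.Kahn2022 (Affects)
open Literature.Probability.Percolation (DeterminedBy)
open Literature.Probability.Percolation.DecisionTree (ind)
open SahiComb

namespace Pointwise

/-! ### 1. The principal-cap stratum at the comb level -/

section PrincipalCap

variable {ι : Type} [Fintype ι]

/-- **(M⁺-3) on the principal-cap stratum.**  Three increasing events whose common part `A ∩ B ∩ C = {T | ↑c ⊆ T}` is a cylinder
have `p ↦ E₃(μ_p; 1_A, 1_B, 1_C)` comb-positive at multidegree `3` (the seven-term certificate of the file header; the cores are
disjointified exactly as in `PrincipalCapC3.sahiE3_nonneg_of_principalCap`; defect moments `μ(Y) − μ(X)`, `X ⊆ Y`, are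
comb-positive by `SahiCombDomination.combPos_ex_sub_of_subset`). [this work] -/
theorem combPos_sahiE3_of_principalCap {A B C : Set (Set ι)} (hA : IsUpperSet A) (hB : IsUpperSet B) (hC : IsUpperSet C)
    (c : Finset ι) (hpc : ∀ T : Set ι, (T ∈ A ∧ T ∈ B ∧ T ∈ C) ↔ (↑c : Set ι) ⊆ T) :
    CombPos (fun _ : ι => 3) (fun p => sahiE (bernoulliWeight p) 3 ![ind A, ind B, ind C]) := by
  -- the cores inside `c`, disjointified (as in `PrincipalCapC3`)
  set KA : Finset ι := c.filter fun e => Set.univ \ {e} ∉ A with hKAdef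
  set KB : Finset ι := (c.filter fun e => Set.univ \ {e} ∉ B) \ KA with hKBdef
  set KC : Finset ι := (c \ KA) \ KB with hKCdef
  have hcA : ∀ e ∈ KA, Set.univ \ {e} ∉ A := fun e he => (mem_filter.1 he).2
  have hcB : ∀ e ∈ KB, Set.univ \ {e} ∉ B := fun e he => (mem_filter.1 (mem_sdiff.1 he).1).2
  have hcC : ∀ e ∈ KC, Set.univ \ {e} ∉ C := by
    intro e he hmem
    have hec : e ∈ c := (mem_sdiff.1 (mem_sdiff.1 he).1).1
    have heA : e ∉ KA := (mem_sdiff.1 (mem_sdiff.1 he).1).2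
    have heB : e ∉ KB := (mem_sdiff.1 he).2
    have hA' : Set.univ \ {e} ∈ A := by
      by_contra h; exact heA (mem_filter.2 ⟨hec, h⟩)
    have hB' : Set.univ \ {e} ∈ B := by
      by_contra h; exact heB (mem_sdiff.2 ⟨mem_filter.2 ⟨hec, h⟩, heA⟩)
    have hsub := (hpc _).1 ⟨hA', hB', hmem⟩
    exact (hsub (mem_coe.2 hec)).2 rfl
  have hAK : A ⊆ {ω : Set ι | (↑KA : Set ι) ⊆ ω} := PrincipalCapC3.subset_cyl_of_core hA hcA
  have hBK : B ⊆ {ω : Set ι | (↑KB : Set ι) ⊆ ω} := PrincipalCapC3.subset_cyl_of_core hB hcB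
  have hCK : C ⊆ {ω : Set ι | (↑KC : Set ι) ⊆ ω} := PrincipalCapC3.subset_cyl_of_core hC hcC
  have hdAB : Disjoint KA KB := disjoint_sdiff
  have hdAC : Disjoint KA KC := by
    rw [Finset.disjoint_left]; intro e heA heC
    exact (mem_sdiff.1 (mem_sdiff.1 heC).1).2 heA
  have hdBC : Disjoint KB KC := by
    rw [Finset.disjoint_left]; intro e heB heC
    exact (mem_sdiff.1 heC).2 heB
  have hcov : KA ∪ KB ∪ KC = c := by
    ext e
    simp only [mem_union]
    constructor
    · rintro ((h | h) | h)
      · exact (mem_filter.1 h).1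
      · exact (mem_filter.1 (mem_sdiff.1 h).1).1
      · exact (mem_sdiff.1 (mem_sdiff.1 h).1).1
    · intro hec
      by_cases hA' : e ∈ KA
      · exact Or.inl (Or.inl hA')
      · by_cases hB' : e ∈ KB
        · exact Or.inl (Or.inr hB')
        · exact Or.inr (mem_sdiff.2 ⟨mem_sdiff.2 ⟨hec, hA'⟩, hB'⟩)
  -- inclusions feeding the defect moments
  have hBCK : B ∩ C ⊆ {ω : Set ι | (↑KB : Set ι) ⊆ ω} ∩ {ω | (↑KC : Set ι) ⊆ ω} := Set.inter_subset_inter hBK hCK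
  have hACK : A ∩ C ⊆ {ω : Set ι | (↑KA : Set ι) ⊆ ω} ∩ {ω | (↑KC : Set ι) ⊆ ω} := Set.inter_subset_inter hAK hCK
  have hABK : A ∩ B ⊆ {ω : Set ι | (↑KA : Set ι) ⊆ ω} ∩ {ω | (↑KB : Set ι) ⊆ ω} := Set.inter_subset_inter hAK hBK
  have hcABC : {ω : Set ι | (↑c : Set ι) ⊆ ω} ⊆ A ∩ B ∩ C := by
    intro ω hω
    obtain ⟨h1, h2, h3⟩ := (hpc ω).2 hω
    exact ⟨⟨h1, h2⟩, h3⟩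
  -- multidegree bookkeeping
  have d11 : (fun _ : ι => (1 : ℕ)) + (fun _ : ι => 1) = fun _ : ι => 2 := by funext e; simp
  have d12 : (fun _ : ι => (1 : ℕ)) + (fun _ : ι => 2) = fun _ : ι => 3 := by funext e; simp
  have d21 : (fun _ : ι => (2 : ℕ)) + (fun _ : ι => 1) = fun _ : ι => 3 := by funext e; simp
  have d13 : (fun _ : ι => (1 : ℕ)) ≤ (fun _ : ι => 3) := fun e => by norm_num
  have d23 : (fun _ : ι => (2 : ℕ)) ≤ (fun _ : ι => 3) := fun e => by norm_num
  -- the seven comb-positive pieces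
  have T1 : CombPos (fun _ : ι => 3) (fun p =>
      (ex (bernoulliWeight p) (ind {ω : Set ι | (↑KA : Set ι) ⊆ ω}) - ex (bernoulliWeight p) (ind A)) *
        (ex (bernoulliWeight p) (ind {ω : Set ι | (↑KB : Set ι) ⊆ ω}) - ex (bernoulliWeight p) (ind B)) *
          ex (bernoulliWeight p) (ind {ω : Set ι | (↑KC : Set ι) ⊆ ω})) :=
    ((SahiCombDomination.combPos_ex_sub_of_subset hAK).mul_of_eq (SahiCombDomination.combPos_ex_sub_of_subset hBK) d11).mul_of_eq (combPos_ex_ind _) d21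
  have T2 : CombPos (fun _ : ι => 3) (fun p =>
      (ex (bernoulliWeight p) (ind {ω : Set ι | (↑KC : Set ι) ⊆ ω}) - ex (bernoulliWeight p) (ind C)) *
        ((ex (bernoulliWeight p) (ind {ω : Set ι | (↑KA : Set ι) ⊆ ω}) - ex (bernoulliWeight p) (ind A)) *
          ex (bernoulliWeight p) (ind {ω : Set ι | (↑KB : Set ι) ⊆ ω}))) :=
    (SahiCombDomination.combPos_ex_sub_of_subset hCK).mul_of_eq ((SahiCombDomination.combPos_ex_sub_of_subset hAK).mul_of_eq (combPos_ex_ind _) d11) d12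
  have T3 : CombPos (fun _ : ι => 3) (fun p =>
      (ex (bernoulliWeight p) (ind {ω : Set ι | (↑KC : Set ι) ⊆ ω}) - ex (bernoulliWeight p) (ind C)) *
        (ex (bernoulliWeight p) (ind A) *
          (ex (bernoulliWeight p) (ind {ω : Set ι | (↑KB : Set ι) ⊆ ω}) - ex (bernoulliWeight p) (ind B)))) :=
    (SahiCombDomination.combPos_ex_sub_of_subset hCK).mul_of_eq ((combPos_ex_ind A).mul_of_eq (SahiCombDomination.combPos_ex_sub_of_subset hBK) d11) d12
  have T4 : CombPos (fun _ : ι => 3) (fun p =>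
      2 * (ex (bernoulliWeight p) (ind (A ∩ B ∩ C)) - ex (bernoulliWeight p) (ind {ω : Set ι | (↑c : Set ι) ⊆ ω}))) :=
    ((SahiCombDomination.combPos_ex_sub_of_subset hcABC).smul (by norm_num : (0 : ℝ) ≤ 2)).mono d13
  have T5 : CombPos (fun _ : ι => 3) (fun p => ex (bernoulliWeight p) (ind A) *
      (ex (bernoulliWeight p) (ind ({ω : Set ι | (↑KB : Set ι) ⊆ ω} ∩ {ω | (↑KC : Set ι) ⊆ ω})) -
        ex (bernoulliWeight p) (ind (B ∩ C)))) :=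
    ((combPos_ex_ind A).mul_of_eq (SahiCombDomination.combPos_ex_sub_of_subset hBCK) d11).mono d23
  have T6 : CombPos (fun _ : ι => 3) (fun p => ex (bernoulliWeight p) (ind B) *
      (ex (bernoulliWeight p) (ind ({ω : Set ι | (↑KA : Set ι) ⊆ ω} ∩ {ω | (↑KC : Set ι) ⊆ ω})) -
        ex (bernoulliWeight p) (ind (A ∩ C)))) :=
    ((combPos_ex_ind B).mul_of_eq (SahiCombDomination.combPos_ex_sub_of_subset hACK) d11).mono d23
  have T7 : CombPos (fun _ : ι => 3) (fun p => ex (bernoulliWeight p) (ind C) *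
      (ex (bernoulliWeight p) (ind ({ω : Set ι | (↑KA : Set ι) ⊆ ω} ∩ {ω | (↑KB : Set ι) ⊆ ω})) -
        ex (bernoulliWeight p) (ind (A ∩ B)))) :=
    ((combPos_ex_ind C).mul_of_eq (SahiCombDomination.combPos_ex_sub_of_subset hABK) d11).mono d23
  refine ((((((T1.add T2).add T3).add T4).add T5).add T6).add T7).congr fun p => ?_
  -- the identity at `p`
  have hPAB : (prodBernoulli p).real ({ω : Set ι | (↑KA : Set ι) ⊆ ω} ∩ {ω : Set ι | (↑KB : Set ι) ⊆ ω}) =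
      (∏ e ∈ KA, (p e : ℝ)) * ∏ e ∈ KB, (p e : ℝ) := by
    rw [PrincipalCapC3.cyl_inter, PrincipalCapC3.real_cyl, prod_union hdAB]
  have hPAC : (prodBernoulli p).real ({ω : Set ι | (↑KA : Set ι) ⊆ ω} ∩ {ω : Set ι | (↑KC : Set ι) ⊆ ω}) =
      (∏ e ∈ KA, (p e : ℝ)) * ∏ e ∈ KC, (p e : ℝ) := by
    rw [PrincipalCapC3.cyl_inter, PrincipalCapC3.real_cyl, prod_union hdAC]
  have hPBC : (prodBernoulli p).real ({ω : Set ι | (↑KB : Set ι) ⊆ ω} ∩ {ω : Set ι | (↑KC : Set ι) ⊆ ω}) =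
      (∏ e ∈ KB, (p e : ℝ)) * ∏ e ∈ KC, (p e : ℝ) := by
    rw [PrincipalCapC3.cyl_inter, PrincipalCapC3.real_cyl, prod_union hdBC]
  have hPABC : (prodBernoulli p).real ({ω : Set ι | (↑c : Set ι) ⊆ ω}) =
      (∏ e ∈ KA, (p e : ℝ)) * (∏ e ∈ KB, (p e : ℝ)) * ∏ e ∈ KC, (p e : ℝ) := by
    rw [← hcov, PrincipalCapC3.real_cyl, prod_union (disjoint_union_left.2 ⟨hdAC, hdBC⟩), prod_union hdAB]
  rw [sahiE_three_ind, sahiE3_def]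
  simp only [ex_bernoulliWeight_ind]
  rw [hPAB, hPAC, hPBC, hPABC, PrincipalCapC3.real_cyl, PrincipalCapC3.real_cyl, PrincipalCapC3.real_cyl]
  ring

/-- The same for a `Fin 3`-family (`fun j => ind (U j)`). [this work] -/
theorem combPos_sahiE_three_of_principalCap (U : Fin 3 → Set (Set ι)) (hU : ∀ j, IsUpperSet (U j)) (c : Finset ι)
    (hpc : ∀ T : Set ι, (∀ j, T ∈ U j) ↔ (↑c : Set ι) ⊆ T) :
    CombPos (fun _ : ι => 3) (fun p => sahiE (bernoulliWeight p) 3 (fun j => ind (U j))) := by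
  have e : (fun j => ind (U j)) = ![ind (U 0), ind (U 1), ind (U 2)] := by
    funext j; fin_cases j <;> rfl
  have hpc' : ∀ T : Set ι, (T ∈ U 0 ∧ T ∈ U 1 ∧ T ∈ U 2) ↔ (↑c : Set ι) ⊆ T := by
    intro T
    rw [← hpc T]
    constructor
    · rintro ⟨h0, h1, h2⟩ j
      fin_cases j
      · exact h0
      · exact h1
      · exact h2
    · intro h; exact ⟨h 0, h 1, h 2⟩
  exact (combPos_sahiE3_of_principalCap (hU 0) (hU 1) (hU 2) c hpc').congr fun p => by rw [e]

/-- Density-free zeros on the principal-cap stratum (closed cube): an interior zero of `E₃` makes it vanish for every `p`. [this work] -/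
theorem sahiE_three_ind_eq_zero_of_interior_zero_of_principalCap (U : Fin 3 → Set (Set ι)) (hU : ∀ j, IsUpperSet (U j))
    (c : Finset ι) (hpc : ∀ T : Set ι, (∀ j, T ∈ U j) ↔ (↑c : Set ι) ⊆ T) {q : ι → unitInterval}
    (hq : ∀ e, (q e : ℝ) ∈ Set.Ioo (0 : ℝ) 1) (h0 : sahiE (bernoulliWeight q) 3 (fun j => ind (U j)) = 0)
    (p : ι → unitInterval) : sahiE (bernoulliWeight p) 3 (fun j => ind (U j)) = 0 :=
  (combPos_sahiE_three_of_principalCap U hU c hpc).eq_zero_of_interior hq h0 p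

end PrincipalCap

section PrincipalCapPointwise

variable {ι : Type} [Fintype ι]

/-- **Pointwise (EQ-3) on the principal-cap stratum**: for `p` in the open cube and three increasing events with cylinder common
part, `E₃(μ_p; 1_U) = 0 ↔ U ∈ Z₃`. [this work] -/
theorem sahiE_three_ind_eq_zero_iff_of_principalCap (p : ι → unitInterval) (hp : ∀ e, (p e : ℝ) ∈ Set.Ioo (0 : ℝ) 1)
    (U : Fin 3 → Set (Set ι)) (hU : ∀ j, IsUpperSet (U j)) (c : Finset ι)
    (hpc : ∀ T : Set ι, (∀ j, T ∈ U j) ↔ (↑c : Set ι) ⊆ T) :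
    sahiE (bernoulliWeight p) 3 (fun j => ind (U j)) = 0 ↔ SuppZeroFlag 3 U :=
  sahiE_ind_eq_zero_iff_of_combPos hU (combPos_sahiE_three_of_principalCap U hU c hpc) hp

/-- Strict form: a principal-cap triple outside `Z₃` has `E₃(μ_p) > 0` at every interior `p`. [this work] -/
theorem sahiE_three_ind_pos_of_principalCap (p : ι → unitInterval) (hp : ∀ e, (p e : ℝ) ∈ Set.Ioo (0 : ℝ) 1)
    (U : Fin 3 → Set (Set ι)) (hU : ∀ j, IsUpperSet (U j)) (c : Finset ι)
    (hpc : ∀ T : Set ι, (∀ j, T ∈ U j) ↔ (↑c : Set ι) ⊆ T) (hZ : ¬ SuppZeroFlag 3 U) :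
    0 < sahiE (bernoulliWeight p) 3 (fun j => ind (U j)) :=
  sahiE_ind_pos_of_combPos hU (combPos_sahiE_three_of_principalCap U hU c hpc) hZ hp

end PrincipalCapPointwise

/-! ### 2. The five comb strata and the `P`-class at order 3 -/

section OrderThree

variable {ι : Type} [Fintype ι]

/-- **Pointwise (EQ-3) on the five comb strata** (`combPos_sahiE_three_of_not_residual`): for `p` in the open cube and three
increasing events with a comparable pair, OR a cylinder member, OR a member determined by `F` while the others are determined by `Fᶜ`,
OR a deleted pair in `Z₂`, OR a member containing the intersection of the other two: `E₃(μ_p; 1_U) = 0 ↔ U ∈ Z₃`. [this work] -/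
theorem sahiE_three_ind_eq_zero_iff_of_not_residual_comb (p : ι → unitInterval) (hp : ∀ e, (p e : ℝ) ∈ Set.Ioo (0 : ℝ) 1)
    (U : Fin 3 → Set (Set ι)) (hU : ∀ j, IsUpperSet (U j))
    (h : (∃ i j : Fin 3, j ≠ i ∧ U j ⊆ U i) ∨ (∃ (m : Fin 3) (S : Set ι), U m = {ω : Set ι | S ⊆ ω}) ∨
      (∃ (m : Fin 3) (F : Finset ι), DeterminedBy (U m) (↑F : Set ι) ∧ ∀ j, DeterminedBy (U (m.succAbove j)) (↑F : Set ι)ᶜ) ∨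
      (∃ m : Fin 3, SuppZeroFlag 2 (fun j => U (m.succAbove j))) ∨
      (∃ m : Fin 3, (⋂ j, U (m.succAbove j)) ⊆ U m)) :
    sahiE (bernoulliWeight p) 3 (fun j => ind (U j)) = 0 ↔ SuppZeroFlag 3 U :=
  sahiE_ind_eq_zero_iff_of_combPos hU (combPos_sahiE_three_of_not_residual U hU h) hp

/-- In particular on the TOTAL-MEET stratum (a member contains the intersection of the other two; not covered by
`sahiE_three_ind_eq_zero_iff_of_not_residual` of `SahiMasterFamilyEqPrincipal`). [this work] -/
theorem sahiE_three_ind_eq_zero_iff_of_totalMeet (p : ι → unitInterval) (hp : ∀ e, (p e : ℝ) ∈ Set.Ioo (0 : ℝ) 1)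
    (U : Fin 3 → Set (Set ι)) (hU : ∀ j, IsUpperSet (U j)) (m : Fin 3) (hmeet : (⋂ j, U (m.succAbove j)) ⊆ U m) :
    sahiE (bernoulliWeight p) 3 (fun j => ind (U j)) = 0 ↔ SuppZeroFlag 3 U :=
  sahiE_three_ind_eq_zero_iff_of_not_residual_comb p hp U hU (Or.inr (Or.inr (Or.inr (Or.inr ⟨m, hmeet⟩))))

/-- Strict form on the five comb strata: outside `Z₃`, `E₃(μ_p) > 0` at every interior `p`. [this work] -/
theorem sahiE_three_ind_pos_of_not_residual_comb (p : ι → unitInterval) (hp : ∀ e, (p e : ℝ) ∈ Set.Ioo (0 : ℝ) 1)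
    (U : Fin 3 → Set (Set ι)) (hU : ∀ j, IsUpperSet (U j))
    (h : (∃ i j : Fin 3, j ≠ i ∧ U j ⊆ U i) ∨ (∃ (m : Fin 3) (S : Set ι), U m = {ω : Set ι | S ⊆ ω}) ∨
      (∃ (m : Fin 3) (F : Finset ι), DeterminedBy (U m) (↑F : Set ι) ∧ ∀ j, DeterminedBy (U (m.succAbove j)) (↑F : Set ι)ᶜ) ∨
      (∃ m : Fin 3, SuppZeroFlag 2 (fun j => U (m.succAbove j))) ∨
      (∃ m : Fin 3, (⋂ j, U (m.succAbove j)) ⊆ U m)) (hZ : ¬ SuppZeroFlag 3 U) :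
    0 < sahiE (bernoulliWeight p) 3 (fun j => ind (U j)) :=
  sahiE_ind_pos_of_combPos hU (combPos_sahiE_three_of_not_residual U hU h) hZ hp

/-- **Pointwise (EQ-3) on the `P`-class**: if the two events other than `U m` intersect in a cylinder `{a ⊆ ω}`, then at every
interior `p`, `E₃(μ_p; 1_U) = 0 ↔ U ∈ Z₃`. [this work] -/
theorem sahiE_three_ind_eq_zero_iff_of_pairInter_eq_cylinder (p : ι → unitInterval)
    (hp : ∀ e, (p e : ℝ) ∈ Set.Ioo (0 : ℝ) 1) (U : Fin 3 → Set (Set ι)) (hU : ∀ j, IsUpperSet (U j)) (m : Fin 3)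
    (a : Set ι) (ha : (⋂ j, U (m.succAbove j)) = {ω : Set ι | a ⊆ ω}) :
    sahiE (bernoulliWeight p) 3 (fun j => ind (U j)) = 0 ↔ SuppZeroFlag 3 U :=
  sahiE_ind_eq_zero_iff_of_combPos hU (SahiCombPrincipalMeet.combPos_sahiE_three_of_pairInter_eq_cylinder U hU m a ha) hp

/-- Strict form on the `P`-class. [this work] -/
theorem sahiE_three_ind_pos_of_pairInter_eq_cylinder (p : ι → unitInterval) (hp : ∀ e, (p e : ℝ) ∈ Set.Ioo (0 : ℝ) 1)
    (U : Fin 3 → Set (Set ι)) (hU : ∀ j, IsUpperSet (U j)) (m : Fin 3) (a : Set ι)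
    (ha : (⋂ j, U (m.succAbove j)) = {ω : Set ι | a ⊆ ω}) (hZ : ¬ SuppZeroFlag 3 U) :
    0 < sahiE (bernoulliWeight p) 3 (fun j => ind (U j)) :=
  sahiE_ind_pos_of_combPos hU (SahiCombPrincipalMeet.combPos_sahiE_three_of_pairInter_eq_cylinder U hU m a ha) hZ hp

end OrderThree

/-! ### 3. Every order: small cores and meet-absorbing families -/

section AllOrders

variable {ι : Type} [Fintype ι]

/-- **Pointwise (EQ-k) at every order for families with a core of at most three coordinates**: if every coordinate outside a set
`S` with `|S| ≤ 3` affects at most one member, then at every interior `p`, `E_{n+1}(μ_p; 1_U) = 0 ↔ U ∈ Z_{n+1}`. [this work] -/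
theorem sahiE_ind_eq_zero_iff_of_core_le_three (p : ι → unitInterval) (hp : ∀ e, (p e : ℝ) ∈ Set.Ioo (0 : ℝ) 1)
    (S : Finset ι) (hS3 : S.card ≤ 3) {n : ℕ} (U : Fin (n + 1) → Set (Set ι)) (hU : ∀ j, IsUpperSet (U j))
    (hpriv : ∀ e, e ∉ S → ∀ j j', Affects (U j) e → Affects (U j') e → j = j') :
    sahiE (bernoulliWeight p) (n + 1) (fun j => ind (U j)) = 0 ↔ SuppZeroFlag (n + 1) U :=
  sahiE_ind_eq_zero_iff_of_combPos hU (SahiCombCore.combPos_sahiE_ind_of_core_le_three S hS3 U hU hpriv) hp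

/-- Strict form for small cores: outside `Z_{n+1}`, `E_{n+1}(μ_p) > 0` at every interior `p`. [this work] -/
theorem sahiE_ind_pos_of_core_le_three (p : ι → unitInterval) (hp : ∀ e, (p e : ℝ) ∈ Set.Ioo (0 : ℝ) 1)
    (S : Finset ι) (hS3 : S.card ≤ 3) {n : ℕ} (U : Fin (n + 1) → Set (Set ι)) (hU : ∀ j, IsUpperSet (U j))
    (hpriv : ∀ e, e ∉ S → ∀ j j', Affects (U j) e → Affects (U j') e → j = j') (hZ : ¬ SuppZeroFlag (n + 1) U) :
    0 < sahiE (bernoulliWeight p) (n + 1) (fun j => ind (U j)) :=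
  sahiE_ind_pos_of_combPos hU (SahiCombCore.combPos_sahiE_ind_of_core_le_three S hS3 U hU hpriv) hZ hp

/-- **Pointwise (EQ-n) for triplewise meet-absorbing families** (among any three members one contains the intersection of the other
two; includes chains and meet towers), every order. [this work] -/
theorem sahiE_ind_eq_zero_iff_of_triplewise (p : ι → unitInterval) (hp : ∀ e, (p e : ℝ) ∈ Set.Ioo (0 : ℝ) 1) {n : ℕ}
    (U : Fin n → Set (Set ι)) (hU : ∀ j, IsUpperSet (U j)) (hT : TriplewiseMeetAbsorbing U) :
    sahiE (bernoulliWeight p) n (fun j => ind (U j)) = 0 ↔ SuppZeroFlag n U :=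
  sahiE_ind_eq_zero_iff_of_combPos hU (combPos_sahiE_ind_of_triplewise n U hU hT) hp

/-- Pointwise (EQ-n) for chains of increasing events, every order. [this work] -/
theorem sahiE_ind_eq_zero_iff_of_chain (p : ι → unitInterval) (hp : ∀ e, (p e : ℝ) ∈ Set.Ioo (0 : ℝ) 1) {n : ℕ}
    (U : Fin n → Set (Set ι)) (hU : ∀ j, IsUpperSet (U j)) (h : ∀ i j : Fin n, U i ⊆ U j ∨ U j ⊆ U i) :
    sahiE (bernoulliWeight p) n (fun j => ind (U j)) = 0 ↔ SuppZeroFlag n U :=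
  sahiE_ind_eq_zero_iff_of_combPos hU (combPos_sahiE_ind_of_chain U hU h) hp

/-- Pointwise (EQ-n) for meet towers (each slot contains the pairwise intersections of all later slots), every order. [this work] -/
theorem sahiE_ind_eq_zero_iff_of_meetTower (p : ι → unitInterval) (hp : ∀ e, (p e : ℝ) ∈ Set.Ioo (0 : ℝ) 1) {n : ℕ}
    (U : Fin n → Set (Set ι)) (hU : ∀ j, IsUpperSet (U j))
    (h : ∀ i j l : Fin n, i < j → i < l → j ≠ l → U j ∩ U l ⊆ U i) :
    sahiE (bernoulliWeight p) n (fun j => ind (U j)) = 0 ↔ SuppZeroFlag n U :=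
  sahiE_ind_eq_zero_iff_of_combPos hU (combPos_sahiE_ind_of_meetTower U hU h) hp

end AllOrders

end Pointwise

end Summit.CriticalPhenomena.PercolationContinuityZ3.Theorems
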